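import Literature.NumberTheory.Automorphic.HermitianLatticeTreeDefs      -- ★ (T1-A) the definitions
import Literature.NumberTheory.Automorphic.IwasawaDecompositionGL         -- ★ `IsUniformizingElement`, `zpowDiagGL`
import HarnessLib

/-!
# The tree of self-dual and `ϖ`-modular lattices — LATTICE CALCULUS: scaling, diagonal and frame-diagonal lattices `latt (P·diag(ϖ^a, ϖ^b))`
# (comparison, intersection, scaling, depth) (Serre, *Trees*, II.1.1)

Topic `NumberTheory/Automorphic`; namespace `Literature.NumberTheory.Automorphic.HermitianLatticeTree`.  THEOREMS ONLY (no definition, no instance, no notation, no named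
fact, no `sorry`).  Part (T1-B) of the lattice-tree road.  Cell `pub/hodgecm-mathlib` (D-0151), crux H413 (stmt-HodgeConjecture-24833), line «N6nsGerm», the Euler–Poincaré road (R2) `stub_N6nsR2EP : RankOneEulerPoincareNonsplit` — a count-free proof of the ELLIPTIC relation (E) of ★ `Rogawski1990/RankOneEulerPoincareGlue` at every TAME non-split place, inert and ramified alike (A-p17 (g22) bytes (T1), co-hand A-p06 (g27) `F0/P3a/A-p06/g27/CENSUS-R2ram-RamifiedEulerPoincare.A-p06g27.md`, LEAD F0P3a-plan (g10) WORDS T9-6 ∕ T9-8).  HONEST LABEL: HC_CM is proved only modulo the printed citations until rung 0 closes; nothing printed is asserted here (elementary lattice algebra over a valuation ring).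

* §4 `latt_mul_of_mem_glInt`, `scaleLattice_latt`, `scaleLattice_scaleLattice`, `scaleLattice_one`, `scaleLattice_le_scaleLattice_iff`, `scaleLattice_le_iff_le_scaleLattice_inv`,
  `mem_latt_diagonal_iff`, `mem_latt_mul_diagonal_iff`.
* §5 (`ϖ` a uniformizing element) `zpow_mem_integer_iff`, `zpow_inv_mul_zpow_mem_iff`, **`latt_mul_diagonal_le_iff`** (`(a,b) ≤ (a′,b′)` iff `a′ ≤ a ∧ b′ ≤ b`),
  `latt_mul_diagonal_inf`, `scaleLattice_zpow_latt_mul_diagonal`, `latt_one_eq_latt_mul_diagonal_zero`, **`latticeDepth_latt_mul_diagonal`** (`= max(a,b)⁺`),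
  `scaleLattice_zpow_latt_one_le_iff`, `latt_mul_diagonal_le_scaleLattice_zpow_latt_one_iff`.

## References
* [Serre1980Trees] J.-P. Serre, *Trees* (1980), Ch. II §1.1 (the tree of `SL₂` over a local field: lattices, adjacency, distance from a base lattice).
* [Jacobowitz1962] R. Jacobowitz, *Hermitian forms over local fields*, Amer. J. Math. 84 (1962), §4, §7–§8 (unimodular and `𝔭`-modular hermitian lattices).
* [BruhatTits1972] F. Bruhat, J. Tits, *Groupes réductifs sur un corps local I*, Publ. IHÉS 41 (1972), §10 (the building of a rank-one group is a tree).
* [Kottwitz1988] R. E. Kottwitz, *Tamagawa numbers*, Ann. of Math. 127 (1988), §2 (facets of the building and the Euler–Poincaré function).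
-/

set_option autoImplicit false

noncomputable section

open scoped ValuativeRel Matrix MatrixGroups
open Matrix ValuativeRel

namespace Literature.NumberTheory.Automorphic.HermitianLatticeTree

variable {E : Type*} [Field E] [ValuativeRel E]

/-! ## §4 Lattice calculus: columns, images, scaling, diagonal lattices -/

section Calculus

/-- `latt (g k) = latt g` for `k ∈ GL₂(𝒪)` (change of basis of the lattice). [cite: Serre1980Trees, II.1.1] -/
theorem latt_mul_of_mem_glInt (g k : GL (Fin 2) E) (hk : k ∈ glInt 2 E) :
    latt ((g * k : GL (Fin 2) E) : Matrix (Fin 2) (Fin 2) E) = latt (g : Matrix (Fin 2) (Fin 2) E) := by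
  rw [eq_comm, latt, latt, span_range_transpose_eq_iff, inv_mul_cancel_left]
  exact hk

/-- `c · latt g = latt (c • g)`. [cite: Serre1980Trees, II.1.1] -/
theorem scaleLattice_latt (c : E) (g : Matrix (Fin 2) (Fin 2) E) : scaleLattice c (latt g) = latt (c • g) := by
  rw [scaleLattice, latt, latt, Submodule.map_span, ← Set.range_comp]
  rfl

/-- Scaling is functorial: `c · (d · M) = (c d) · M`. [cite: Serre1980Trees, II.1.1] -/
theorem scaleLattice_scaleLattice (c d : E) (M : Submodule 𝒪[E] (Fin 2 → E)) : scaleLattice c (scaleLattice d M) = scaleLattice (c * d) M := by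
  rw [scaleLattice, scaleLattice, scaleLattice, ← Submodule.map_comp]
  congr 1
  apply LinearMap.ext
  intro x
  simp [mul_smul]

/-- `1 · M = M`. [cite: Serre1980Trees, II.1.1] -/
theorem scaleLattice_one (M : Submodule 𝒪[E] (Fin 2 → E)) : scaleLattice 1 M = M := by
  rw [scaleLattice]
  convert Submodule.map_id M
  apply LinearMap.ext
  intro x
  simp

/-- Scaling by `c ≠ 0` is monotone and reflects the order. [cite: Serre1980Trees, II.1.1] -/
theorem scaleLattice_le_scaleLattice_iff {c : E} (hc : c ≠ 0) (M N : Submodule 𝒪[E] (Fin 2 → E)) :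
    scaleLattice c M ≤ scaleLattice c N ↔ M ≤ N := by
  refine Submodule.map_le_map_iff_of_injective (fun x y hxy => ?_) M N
  have h := congrArg (fun z : Fin 2 → E => c⁻¹ • z) hxy
  simpa only [LinearMap.coe_restrictScalars, LinearMap.smul_apply, LinearMap.id_coe, id_eq, smul_smul, inv_mul_cancel₀ hc, one_smul] using h

/-- `c · M ≤ N ↔ M ≤ c⁻¹ · N` (`c ≠ 0`). [cite: Serre1980Trees, II.1.1] -/
theorem scaleLattice_le_iff_le_scaleLattice_inv {c : E} (hc : c ≠ 0) (M N : Submodule 𝒪[E] (Fin 2 → E)) :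
    scaleLattice c M ≤ N ↔ M ≤ scaleLattice c⁻¹ N := by
  rw [← scaleLattice_le_scaleLattice_iff hc M (scaleLattice c⁻¹ N), scaleLattice_scaleLattice, mul_inv_cancel₀ hc, scaleLattice_one]

/-- MEMBERSHIP IN A DIAGONAL LATTICE: `x ∈ latt (diagonal d) ↔ (d i)⁻¹ x i ∈ 𝒪` for all `i` (`d i ≠ 0`). [cite: Serre1980Trees, II.1.1] -/
theorem mem_latt_diagonal_iff {d : Fin 2 → E} (hd : ∀ i, d i ≠ 0) (x : Fin 2 → E) :
    x ∈ latt (Matrix.diagonal d) ↔ ∀ i, (d i)⁻¹ * x i ∈ 𝒪[E] := by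
  rw [latt, Matrix.diagonal_transpose, Submodule.mem_span_range_iff_exists_fun]
  have key : ∀ (c : Fin 2 → 𝒪[E]) (k : Fin 2), (∑ i, c i • Matrix.diagonal d i) k = (c k : E) * d k := by
    intro c k
    rw [Finset.sum_apply]
    simp only [show ∀ (a : 𝒪[E]) (w : Fin 2 → E) (k : Fin 2), (a • w) k = (a : E) * w k from fun _ _ _ => rfl, Matrix.diagonal_apply,
      mul_ite, mul_zero]
    rw [Finset.sum_eq_single k (fun i _ hik => if_neg hik) (fun h => (h (Finset.mem_univ k)).elim), if_pos rfl]
  constructor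
  · rintro ⟨c, rfl⟩ i
    rw [key, mul_comm ((c i : E)) (d i), ← mul_assoc, inv_mul_cancel₀ (hd i), one_mul]
    exact (c i).2
  · intro hx
    refine ⟨fun i => ⟨(d i)⁻¹ * x i, hx i⟩, ?_⟩
    funext k
    rw [key]
    change (d k)⁻¹ * x k * d k = x k
    rw [mul_comm, ← mul_assoc, mul_inv_cancel₀ (hd k), one_mul]

/-- Membership in `P · latt (diagonal d)`: `x ∈ latt (P · diagonal d) ↔ (d i)⁻¹ (P⁻¹ x) i ∈ 𝒪` for all `i`. [cite: Serre1980Trees, II.1.1] -/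
theorem mem_latt_mul_diagonal_iff (P : GL (Fin 2) E) {d : Fin 2 → E} (hd : ∀ i, d i ≠ 0) (x : Fin 2 → E) :
    x ∈ latt ((P : Matrix (Fin 2) (Fin 2) E) * Matrix.diagonal d) ↔ ∀ i, (d i)⁻¹ * (((P⁻¹ : GL (Fin 2) E) : Matrix (Fin 2) (Fin 2) E) *ᵥ x) i ∈ 𝒪[E] := by
  rw [latt_mul, Submodule.mem_map]
  constructor
  · rintro ⟨y, hy, rfl⟩
    simpa only [LinearMap.coe_restrictScalars, Matrix.toLin'_apply, Matrix.mulVec_mulVec, ← Units.val_mul, inv_mul_cancel, Units.val_one,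
      Matrix.one_mulVec] using (mem_latt_diagonal_iff hd y).1 hy
  · intro hx
    refine ⟨((P⁻¹ : GL (Fin 2) E) : Matrix (Fin 2) (Fin 2) E) *ᵥ x, (mem_latt_diagonal_iff hd _).2 hx, ?_⟩
    simp only [LinearMap.coe_restrictScalars, Matrix.toLin'_apply, Matrix.mulVec_mulVec, ← Units.val_mul, mul_inv_cancel, Units.val_one,
      Matrix.one_mulVec]

end Calculus

/-! ## §5 Frame-diagonal lattices `latt (P · diag(ϖ^a, ϖ^b))` -/

section Diagonal

variable {ϖ : E} (hϖ : IsUniformizingElement ϖ)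

include hϖ in
/-- `ϖ^d ∈ 𝒪 ⟺ 0 ≤ d` (local copy of ★ `zpow_uniformizer_mem_integer_iff`). [cite: Serre1980Trees, II.1.1] -/
theorem zpow_mem_integer_iff (d : ℤ) : ϖ ^ d ∈ 𝒪[E] ↔ 0 ≤ d := by
  constructor
  · intro h
    by_contra hd
    have h' : ϖ ^ (-d) ∈ 𝒪[E] := by
      obtain ⟨n, hn⟩ := Int.eq_ofNat_of_zero_le (show 0 ≤ -d by omega)
      rw [hn, zpow_natCast]
      exact hϖ.pow_mem n
    have := hϖ.eq_zero_of_zpow_mem h h'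
    omega
  · intro hd
    obtain ⟨n, rfl⟩ := Int.eq_ofNat_of_zero_le hd
    rw [zpow_natCast]
    exact hϖ.pow_mem n

include hϖ in
/-- `(ϖ^a)⁻¹ · (ϖ^b x) ∈ 𝒪` for `x ∈ 𝒪`-scaled… precisely: `(ϖ^a')⁻¹ * ϖ^a ∈ 𝒪 ↔ a' ≤ a`. [cite: Serre1980Trees, II.1.1] -/
theorem zpow_inv_mul_zpow_mem_iff (a a' : ℤ) : (ϖ ^ a')⁻¹ * ϖ ^ a ∈ 𝒪[E] ↔ a' ≤ a := by
  rw [← _root_.zpow_neg, ← zpow_add₀ hϖ.ne_zero, zpow_mem_integer_iff hϖ]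
  omega

include hϖ in
/-- COMPARISON of frame-diagonal lattices: `latt (P·diag(ϖ^a, ϖ^b)) ≤ latt (P·diag(ϖ^{a′}, ϖ^{b′})) ↔ a′ ≤ a ∧ b′ ≤ b`. [cite: Serre1980Trees, II.1.1] -/
theorem latt_mul_diagonal_le_iff (P : GL (Fin 2) E) (a b a' b' : ℤ) :
    latt ((P : Matrix (Fin 2) (Fin 2) E) * Matrix.diagonal ![ϖ ^ a, ϖ ^ b]) ≤
        latt ((P : Matrix (Fin 2) (Fin 2) E) * Matrix.diagonal ![ϖ ^ a', ϖ ^ b']) ↔ a' ≤ a ∧ b' ≤ b := by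
  have hd : ∀ i, (![ϖ ^ a, ϖ ^ b] : Fin 2 → E) i ≠ 0 := by
    intro i; fin_cases i <;> simp [zpow_ne_zero _ hϖ.ne_zero]
  have hd' : ∀ i, (![ϖ ^ a', ϖ ^ b'] : Fin 2 → E) i ≠ 0 := by
    intro i; fin_cases i <;> simp [zpow_ne_zero _ hϖ.ne_zero]
  constructor
  · intro h
    -- test the two columns `ϖ^a P e₀`, `ϖ^b P e₁`
    have hcol : ∀ j : Fin 2, ((P : Matrix (Fin 2) (Fin 2) E) * Matrix.diagonal ![ϖ ^ a, ϖ ^ b])ᵀ j ∈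
        latt ((P : Matrix (Fin 2) (Fin 2) E) * Matrix.diagonal ![ϖ ^ a', ϖ ^ b']) :=
      fun j => h (Submodule.subset_span ⟨j, rfl⟩)
    have key : ∀ j : Fin 2, ((![ϖ ^ a', ϖ ^ b'] : Fin 2 → E) j)⁻¹ * (![ϖ ^ a, ϖ ^ b] : Fin 2 → E) j ∈ 𝒪[E] := by
      intro j
      have hj := (mem_latt_mul_diagonal_iff P hd' _).1 (hcol j) j
      have hcomp : (((P⁻¹ : GL (Fin 2) E) : Matrix (Fin 2) (Fin 2) E) *ᵥ ((P : Matrix (Fin 2) (Fin 2) E) * Matrix.diagonal ![ϖ ^ a, ϖ ^ b])ᵀ j) j =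
          (![ϖ ^ a, ϖ ^ b] : Fin 2 → E) j := by
        rw [mulVec_transpose_apply, ← Matrix.mul_assoc, ← Units.val_mul, inv_mul_cancel, Units.val_one, Matrix.one_mul,
          Matrix.diagonal_transpose, Matrix.diagonal_apply_eq]
      rwa [hcomp] at hj
    have k0 := key 0
    have k1 := key 1
    simp only [Matrix.cons_val_zero, Matrix.cons_val_one] at k0 k1
    exact ⟨(zpow_inv_mul_zpow_mem_iff hϖ a a').1 k0, (zpow_inv_mul_zpow_mem_iff hϖ b b').1 k1⟩
  · rintro ⟨ha, hb⟩ x hx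
    rw [mem_latt_mul_diagonal_iff P hd] at hx
    rw [mem_latt_mul_diagonal_iff P hd']
    intro i
    have h1 := hx i
    have hfac : ((![ϖ ^ a', ϖ ^ b'] : Fin 2 → E) i)⁻¹ * (((P⁻¹ : GL (Fin 2) E) : Matrix (Fin 2) (Fin 2) E) *ᵥ x) i =
        (((![ϖ ^ a', ϖ ^ b'] : Fin 2 → E) i)⁻¹ * (![ϖ ^ a, ϖ ^ b] : Fin 2 → E) i) *
          ((((![ϖ ^ a, ϖ ^ b] : Fin 2 → E) i))⁻¹ * (((P⁻¹ : GL (Fin 2) E) : Matrix (Fin 2) (Fin 2) E) *ᵥ x) i) := by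
      rw [mul_assoc, mul_inv_cancel_left₀ (hd i)]
    rw [hfac]
    refine Subring.mul_mem _ ?_ h1
    fin_cases i
    · simpa using (zpow_inv_mul_zpow_mem_iff hϖ a a').2 ha
    · simpa using (zpow_inv_mul_zpow_mem_iff hϖ b b').2 hb

include hϖ in
/-- INTERSECTION of frame-diagonal lattices: `latt (P·diag(ϖ^a, ϖ^b)) ⊓ latt (P·diag(ϖ^{a′}, ϖ^{b′})) = latt (P·diag(ϖ^{max a a′}, ϖ^{max b b′}))`.
[cite: Serre1980Trees, II.1.1] -/
theorem latt_mul_diagonal_inf (P : GL (Fin 2) E) (a b a' b' : ℤ) :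
    latt ((P : Matrix (Fin 2) (Fin 2) E) * Matrix.diagonal ![ϖ ^ a, ϖ ^ b]) ⊓ latt ((P : Matrix (Fin 2) (Fin 2) E) * Matrix.diagonal ![ϖ ^ a', ϖ ^ b']) =
      latt ((P : Matrix (Fin 2) (Fin 2) E) * Matrix.diagonal ![ϖ ^ max a a', ϖ ^ max b b']) := by
  apply le_antisymm
  · intro x hx
    obtain ⟨h1, h2⟩ := Submodule.mem_inf.1 hx
    have hd : ∀ i, (![ϖ ^ a, ϖ ^ b] : Fin 2 → E) i ≠ 0 := by intro i; fin_cases i <;> simp [zpow_ne_zero _ hϖ.ne_zero]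
    have hd' : ∀ i, (![ϖ ^ a', ϖ ^ b'] : Fin 2 → E) i ≠ 0 := by intro i; fin_cases i <;> simp [zpow_ne_zero _ hϖ.ne_zero]
    have hd'' : ∀ i, (![ϖ ^ max a a', ϖ ^ max b b'] : Fin 2 → E) i ≠ 0 := by intro i; fin_cases i <;> simp [zpow_ne_zero _ hϖ.ne_zero]
    rw [mem_latt_mul_diagonal_iff P hd] at h1
    rw [mem_latt_mul_diagonal_iff P hd'] at h2
    rw [mem_latt_mul_diagonal_iff P hd'']
    intro i
    fin_cases i
    · rcases le_total a a' with h | h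
      · simpa [max_eq_right h] using h2 0
      · simpa [max_eq_left h] using h1 0
    · rcases le_total b b' with h | h
      · simpa [max_eq_right h] using h2 1
      · simpa [max_eq_left h] using h1 1
  · exact le_inf ((latt_mul_diagonal_le_iff hϖ P _ _ _ _).2 ⟨le_max_left _ _, le_max_left _ _⟩)
      ((latt_mul_diagonal_le_iff hϖ P _ _ _ _).2 ⟨le_max_right _ _, le_max_right _ _⟩)

include hϖ in
/-- SCALING a frame-diagonal lattice: `ϖ^c · latt (P·diag(ϖ^a, ϖ^b)) = latt (P·diag(ϖ^{a+c}, ϖ^{b+c}))`. [cite: Serre1980Trees, II.1.1] -/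
theorem scaleLattice_zpow_latt_mul_diagonal (P : GL (Fin 2) E) (a b c : ℤ) :
    scaleLattice (ϖ ^ c) (latt ((P : Matrix (Fin 2) (Fin 2) E) * Matrix.diagonal ![ϖ ^ a, ϖ ^ b])) =
      latt ((P : Matrix (Fin 2) (Fin 2) E) * Matrix.diagonal ![ϖ ^ (a + c), ϖ ^ (b + c)]) := by
  rw [scaleLattice_latt, ← Matrix.mul_smul, Matrix.smul_eq_diagonal_mul, Matrix.diagonal_mul_diagonal]
  congr 3
  funext i
  fin_cases i
  · simp [zpow_add₀ hϖ.ne_zero, mul_comm]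
  · simp [zpow_add₀ hϖ.ne_zero, mul_comm]

/-- THE ROOT in any integral frame: `latt 1 = latt (P·diag(ϖ^0, ϖ^0))` for `P ∈ GL₂(𝒪)`. [cite: Serre1980Trees, II.1.1] -/
theorem latt_one_eq_latt_mul_diagonal_zero (P : GL (Fin 2) E) (hP : P ∈ glInt 2 E) :
    latt (1 : Matrix (Fin 2) (Fin 2) E) = latt ((P : Matrix (Fin 2) (Fin 2) E) * Matrix.diagonal ![ϖ ^ (0 : ℤ), ϖ ^ (0 : ℤ)]) := by
  have h1 : Matrix.diagonal ![ϖ ^ (0 : ℤ), ϖ ^ (0 : ℤ)] = (1 : Matrix (Fin 2) (Fin 2) E) := by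
    rw [← Matrix.diagonal_one]; congr; funext i; fin_cases i <;> simp
  rw [h1, Matrix.mul_one]
  have := latt_mul_of_mem_glInt 1 P hP
  rw [one_mul] at this
  rw [this, Units.val_one]

include hϖ in
/-- THE DEPTH of a frame-diagonal lattice (`P ∈ GL₂(𝒪)`): `latticeDepth ϖ (latt (P·diag(ϖ^a, ϖ^b))) = max(a, b)⁺`. [cite: Serre1980Trees, II.1.1] -/
theorem latticeDepth_latt_mul_diagonal (P : GL (Fin 2) E) (hP : P ∈ glInt 2 E) (a b : ℤ) :
    latticeDepth ϖ (latt ((P : Matrix (Fin 2) (Fin 2) E) * Matrix.diagonal ![ϖ ^ a, ϖ ^ b])) = (max a b).toNat := by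
  have hset : {k : ℕ | scaleLattice (ϖ ^ k) (latt (1 : Matrix (Fin 2) (Fin 2) E)) ≤ latt ((P : Matrix (Fin 2) (Fin 2) E) * Matrix.diagonal ![ϖ ^ a, ϖ ^ b])} =
      {k : ℕ | max a b ≤ (k : ℤ)} := by
    ext k
    simp only [Set.mem_setOf_eq]
    rw [latt_one_eq_latt_mul_diagonal_zero P hP, ← zpow_natCast, scaleLattice_zpow_latt_mul_diagonal hϖ, zero_add,
      latt_mul_diagonal_le_iff hϖ, max_le_iff]
  rw [latticeDepth, hset]
  apply le_antisymm
  · exact Nat.sInf_le (by simp : (max a b).toNat ∈ {k : ℕ | max a b ≤ (k : ℤ)})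
  · exact le_csInf ⟨(max a b).toNat, by simp⟩ fun k hk => by simpa using hk

include hϖ in
/-- `ϖ^k L₀ ≤ latt (P·diag(ϖ^a, ϖ^b)) ↔ a ≤ k ∧ b ≤ k` (`P ∈ GL₂(𝒪)`). [cite: Serre1980Trees, II.1.1] -/
theorem scaleLattice_zpow_latt_one_le_iff (P : GL (Fin 2) E) (hP : P ∈ glInt 2 E) (a b k : ℤ) :
    scaleLattice (ϖ ^ k) (latt (1 : Matrix (Fin 2) (Fin 2) E)) ≤ latt ((P : Matrix (Fin 2) (Fin 2) E) * Matrix.diagonal ![ϖ ^ a, ϖ ^ b]) ↔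
      a ≤ k ∧ b ≤ k := by
  rw [latt_one_eq_latt_mul_diagonal_zero P hP, scaleLattice_zpow_latt_mul_diagonal hϖ, zero_add, latt_mul_diagonal_le_iff hϖ]

include hϖ in
/-- `latt (P·diag(ϖ^a, ϖ^b)) ≤ ϖ^k L₀ ↔ k ≤ a ∧ k ≤ b` (`P ∈ GL₂(𝒪)`). [cite: Serre1980Trees, II.1.1] -/
theorem latt_mul_diagonal_le_scaleLattice_zpow_latt_one_iff (P : GL (Fin 2) E) (hP : P ∈ glInt 2 E) (a b k : ℤ) :
    latt ((P : Matrix (Fin 2) (Fin 2) E) * Matrix.diagonal ![ϖ ^ a, ϖ ^ b]) ≤ scaleLattice (ϖ ^ k) (latt (1 : Matrix (Fin 2) (Fin 2) E)) ↔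
      k ≤ a ∧ k ≤ b := by
  rw [latt_one_eq_latt_mul_diagonal_zero P hP, scaleLattice_zpow_latt_mul_diagonal hϖ, zero_add, latt_mul_diagonal_le_iff hϖ]

end Diagonal

end Literature.NumberTheory.Automorphic.HermitianLatticeTree

end
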